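import Summits.MatrixMultiplication.MatrixMultiplication.Theses.HyperbolicRankMethods

/-!
# Birth skeleton (BC3) for the piece `HypMatMulUnbounded` (stmt-MatrixMultiplication-10089)
of the BC2 redirect of `HypSuperquadratic` (stmt-MatrixMultiplication-10086), route HyperbolicRankMethods.

Line `restriction-transfer` (lens: transfer, with the why-easier): look for the unbounded escape NOT
at `⟨n,n,n⟩` itself — whose `GL_n^3`-symmetry pushes every natural hyperbolic `h` to an isotropic
`p ∘ λ`, which only truncates matrix rank (BauschkeEtAl2001 Thm 3.1, the route's own worry) — but at
RESTRICTIONS `t = (A ⊗ B ⊗ C)·⟨n,n,n⟩ ∈ ℂ^m ⊗ ℂ^m ⊗ ℂ^m` of matrix multiplication (symmetry-free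
degenerations: truncated / skew / Coppersmith–Winograd-like tensors, `m ≪ n²`, where hyperbolic
programming is feasible), and PULL THE CERTIFICATE BACK along the restriction.
* `stub_pullback` — hyperbolic rank methods pull back along restrictions with the same `(h, e, k)`:
  `Φ' := Φ ∘ (A ⊗ B ⊗ C)` sends rank-one to rank-one and has value `Rank_h(Φ t)` at `⟨n,n,n⟩`.
  TRUE; a genuine Lean lemma (the `ℝ`-linear coordinate map `A ⊗ B ⊗ C`, size M).
* `stub_escapeAtRestriction` — the CORE: for every `C` some restriction `t` of some `⟨n,n,n⟩`
  carries a hyperbolic rank method with `C·k·n² < Rank_h(Φ t)` (so necessarily `bR(t) > C n²`).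
* `HypMatMulUnbounded_of` — the composition.
Sorries ONLY inside the two stubs.
-/

open scoped BigOperators

namespace Summit.MatrixMultiplication.MatrixMultiplication.Cruxes.HypSuperquadratic.RestrictionTransfer

open Summit.MatrixMultiplication.MatrixMultiplication.Theses.HyperbolicRankMethods

/-- STUB (true, size M): pull-back of a hyperbolic rank method along a restriction
`t = (A ⊗ B ⊗ C)·⟨n,n,n⟩`; same `h, e, d, N, k`, value at `⟨n,n,n⟩` equal to the value at `t`. -/
theorem stub_pullback : ∀ (n m : ℕ) (N d k : ℕ) (h : MvPolynomial (Fin N) ℝ) (e : Fin N → ℝ) (Φ : (Fin m → Fin m → Fin m → ℂ) →ₗ[ℝ] (Fin N → ℝ)) (A B C : Fin m → Fin n × Fin n → ℂ), h.IsHomogeneous d → MvPolynomial.eval e h ≠ 0 → (∀ w : Fin N → ℝ, Multiset.card (MvPolynomial.aeval (fun i => Polynomial.C (w i) + Polynomial.C (e i) * Polynomial.X) h).roots = d) → (∀ u v : Fin N → ℝ, (d - (MvPolynomial.aeval (fun i => Polynomial.C ((u + v) i) + Polynomial.C (e i) * Polynomial.X) h).natTrailingDegree) ≤ (d - (MvPolynomial.aeval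 (fun i => Polynomial.C (u i) + Polynomial.C (e i) * Polynomial.X) h).natTrailingDegree) + (d - (MvPolynomial.aeval (fun i => Polynomial.C (v i) + Polynomial.C (e i) * Polynomial.X) h).natTrailingDegree)) → (∀ w u v : Fin m → ℂ, (d - (MvPolynomial.aeval (fun i => Polynomial.C ((Φ (Literature.Computability.AlgebraicComplexity.triad w u v)) i) + Polynomial.C (e i) * Polynomial.X) h).natTrailingDegree) ≤ k) → ∃ Φ' : (Fin n × Fin n → Fin n × Fin n → Fin n × Fin n → ℂ) →ₗ[ℝ] (Fin N → ℝ), (∀ w u v : Fin n × Fin n → ℂ, (d - (MvPolynomial.aeval (fun i => Polynomial.C ((Φ' (Literature.Computability.AlgebraicComplexity.triad w u v)) i) + Polynomial.C (e i) * Polynomial.X) h).natTrailingDegree) ≤ k) ∧ (d - (MvPolynomial.aeval (fun i => Polynomial.C ((Φ' (Literature.Computability.AlgebraicComplexity.matMulTensor ℂ n n n)) i) + Polynomial.C (e i) * Polynomial.X) h).natTrailingDegree) = (d - (MvPolynomial.aeval (fun i => Polynomial.C ((Φ ((fun a b c => ∑ p : Fin n × Fin n, ∑ q : Fin n × Fin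 n, ∑ s : Fin n × Fin n, A a p * B b q * C c s * Literature.Computability.AlgebraicComplexity.matMulTensor ℂ n n n p q s))) i) + Polynomial.C (e i) * Polynomial.X) h).natTrailingDegree) := by
  sorry

/-- STUB (the core, open): unbounded hyperbolic escape at SOME restriction of matrix
multiplication, measured against `n²`. -/
theorem stub_escapeAtRestriction : ∀ Cc : ℕ, ∃ n : ℕ, 1 ≤ n ∧ ∃ (m : ℕ) (N d k : ℕ) (h : MvPolynomial (Fin N) ℝ) (e : Fin N → ℝ) (Φ : (Fin m → Fin m → Fin m → ℂ) →ₗ[ℝ] (Fin N → ℝ)) (A B C : Fin m → Fin n × Fin n → ℂ), (h.IsHomogeneous d ∧ MvPolynomial.eval e h ≠ 0 ∧ (∀ w : Fin N → ℝ, Multiset.card (MvPolynomial.aeval (fun i => Polynomial.C (w i) + Polynomial.C (e i) * Polynomial.X) h).roots = d) ∧ (∀ u v : Fin N → ℝ, (d - (MvPolynomial.aeval (fun i => Polynomial.C ((u + v) i) + Polynomial.C (e i) * Polynomial.X) h).natTrailingDegree) ≤ (d - (MvPolynomial.aeval (fun i => Polynomial.C (u i) + Polynomial.C (e i) * Polynomial.X)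 h).natTrailingDegree) + (d - (MvPolynomial.aeval (fun i => Polynomial.C (v i) + Polynomial.C (e i) * Polynomial.X) h).natTrailingDegree)) ∧ (∀ w u v : Fin m → ℂ, (d - (MvPolynomial.aeval (fun i => Polynomial.C ((Φ (Literature.Computability.AlgebraicComplexity.triad w u v)) i) + Polynomial.C (e i) * Polynomial.X) h).natTrailingDegree) ≤ k)) ∧ Cc * k * n ^ 2 < (d - (MvPolynomial.aeval (fun i => Polynomial.C ((Φ ((fun a b c => ∑ p : Fin n × Fin n, ∑ q : Fin n × Fin n, ∑ s : Fin n × Fin n, A a p * B b q * C c s * Literature.Computability.AlgebraicComplexity.matMulTensor ℂ n n n p q s))) i) + Polynomial.C (e i) * Polynomial.X) h).natTrailingDegree) := by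
  sorry

/-- COMPOSITION with explicit hypotheses (kernel-checked, sorry-free): pull the escape back to `⟨n,n,n⟩`. -/
theorem hypMatMulUnbounded_of_transfer : (∀ (n m : ℕ) (N d k : ℕ) (h : MvPolynomial (Fin N) ℝ) (e : Fin N → ℝ) (Φ : (Fin m → Fin m → Fin m → ℂ) →ₗ[ℝ] (Fin N → ℝ)) (A B C : Fin m → Fin n × Fin n → ℂ), h.IsHomogeneous d → MvPolynomial.eval e h ≠ 0 → (∀ w : Fin N → ℝ, Multiset.card (MvPolynomial.aeval (fun i => Polynomial.C (w i) + Polynomial.C (e i) * Polynomial.X) h).roots = d) → (∀ u v : Fin N → ℝ, (d - (MvPolynomial.aeval (fun i => Polynomial.C ((u + v) i) + Polynomial.C (e i) * Polynomial.X) h).natTrailingDegree) ≤ (d - (MvPolynomial.aeval (fun i => Polynomial.C (u i) + Polynomial.C (e i) * Polynomial.X) h).natTrailingDegree) + (d - (MvPolynomial.aeval (fun i => Polynomial.C (v i) + Polynomial.C (e i) * Polynomial.X) h).natTrailingDegree)) → (∀ w u v : Fin m → ℂ, (d - (MvPolynomial.aeval (fun i => Polynomial.C ((Φ (Literature.Computability.AlgebraicComplexity.triad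 w u v)) i) + Polynomial.C (e i) * Polynomial.X) h).natTrailingDegree) ≤ k) → ∃ Φ' : (Fin n × Fin n → Fin n × Fin n → Fin n × Fin n → ℂ) →ₗ[ℝ] (Fin N → ℝ), (∀ w u v : Fin n × Fin n → ℂ, (d - (MvPolynomial.aeval (fun i => Polynomial.C ((Φ' (Literature.Computability.AlgebraicComplexity.triad w u v)) i) + Polynomial.C (e i) * Polynomial.X) h).natTrailingDegree) ≤ k) ∧ (d - (MvPolynomial.aeval (fun i => Polynomial.C ((Φ' (Literature.Computability.AlgebraicComplexity.matMulTensor ℂ n n n)) i) + Polynomial.C (e i) * Polynomial.X) h).natTrailingDegree) = (d - (MvPolynomial.aeval (fun i => Polynomial.C ((Φ ((fun a b c => ∑ p : Fin n × Fin n, ∑ q : Fin n × Fin n, ∑ s : Fin n × Fin n, A a p * B b q * C c s * Literature.Computability.AlgebraicComplexity.matMulTensor ℂ n n n p q s))) i) + Polynomial.C (e i) * Polynomial.X) h).natTrailingDegree)) → (∀ Cc : ℕ, ∃ n : ℕ, 1 ≤ n ∧ ∃ (m : ℕ) (N d k : ℕ) (h : MvPolynomial (Fin N) ℝ) (e : Fin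 N → ℝ) (Φ : (Fin m → Fin m → Fin m → ℂ) →ₗ[ℝ] (Fin N → ℝ)) (A B C : Fin m → Fin n × Fin n → ℂ), (h.IsHomogeneous d ∧ MvPolynomial.eval e h ≠ 0 ∧ (∀ w : Fin N → ℝ, Multiset.card (MvPolynomial.aeval (fun i => Polynomial.C (w i) + Polynomial.C (e i) * Polynomial.X) h).roots = d) ∧ (∀ u v : Fin N → ℝ, (d - (MvPolynomial.aeval (fun i => Polynomial.C ((u + v) i) + Polynomial.C (e i) * Polynomial.X) h).natTrailingDegree) ≤ (d - (MvPolynomial.aeval (fun i => Polynomial.C (u i) + Polynomial.C (e i) * Polynomial.X) h).natTrailingDegree) + (d - (MvPolynomial.aeval (fun i => Polynomial.C (v i) + Polynomial.C (e i) * Polynomial.X) h).natTrailingDegree)) ∧ (∀ w u v : Fin m → ℂ, (d - (MvPolynomial.aeval (fun i => Polynomial.C ((Φ (Literature.Computability.AlgebraicComplexity.triad w u v)) i) + Polynomial.C (e i) * Polynomial.X) h).natTrailingDegree) ≤ k)) ∧ Cc * k * n ^ 2 < (d - (MvPolynomial.aeval (fun i => Polynomial.C ((Φ ((fun a b c =>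 ∑ p : Fin n × Fin n, ∑ q : Fin n × Fin n, ∑ s : Fin n × Fin n, A a p * B b q * C c s * Literature.Computability.AlgebraicComplexity.matMulTensor ℂ n n n p q s))) i) + Polynomial.C (e i) * Polynomial.X) h).natTrailingDegree)) → HypMatMulUnbounded := by
  intro hP hE
  unfold HypMatMulUnbounded
  intro Cc
  obtain ⟨n, hn, m, N, d, k, h, e, Φ, A, B, C, ⟨hhom, he, hroots, hsub, hone⟩, hval⟩ := hE Cc
  obtain ⟨Φ', hone', hval'⟩ := hP n m N d k h e Φ A B C hhom he hroots hsub hone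
  refine ⟨n, hn, N, d, k, h, e, Φ', hhom, he, hroots, hsub, hone', ?_⟩
  rw [hval']
  exact hval

/-- **THE SKELETON THEOREM.** The piece `HypMatMulUnbounded` (stmt-MatrixMultiplication-10089) BY NAME from the
two DECLARED stubs `stub_pullback`, `stub_escapeAtRestriction` (the file's only `sorry`s) through the sorry-free
composition `hypMatMulUnbounded_of_transfer`. -/
theorem HypMatMulUnbounded_of : HypMatMulUnbounded :=
  hypMatMulUnbounded_of_transfer stub_pullback stub_escapeAtRestriction

end Summit.MatrixMultiplication.MatrixMultiplication.Cruxes.HypSuperquadratic.RestrictionTransfer
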